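import Mathlib
import HarnessLib
import Summits.NavierStokesRegularity.NavierStokesRegularity.Theorems.AxisTwistDoorAveragedConeLiouvilleSmallScales
import Summits.NavierStokesRegularity.NavierStokesRegularity.Theorems.AxisTwistDoorAveragedConeLiouvilleSmoothRep
import Summits.NavierStokesRegularity.NavierStokesRegularity.Theorems.AxisTwistDoorAveragedConeLiouvilleUnzoom

/-!
# Route `AxisTwistDoor`, crux `AveragedConeLiouville` (stmt-NavierStokesRegularity-26889) — toward replacing the
# Lei–Ren input (programme R2), piece S6b (lid part): EVENTUAL POINTWISE BOUNDS BELOW A COMPACT SET OF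
# BACKWARD-REGULAR LID POINTS

Composition of pieces S5a (`eventually_small_cknC_add_cknD`), S5b (`exists_smooth_rep_of_small`) and S5c
(`pointwise_bounds_of_smooth_rep`): for suitable weak solutions `(v_k, q_k)` on `Q(0,1)` (bounded in `L³ × L^{3/2}`,
converging to `u` strongly in `L³` on `K ⊆ Q(0,1)`), CONTINUOUS on `Q(0,1)` (as the route's class profiles are), and a
COMPACT set `X` of positions `x` at which the limit `u` is backward-regular at the lid point `(0, x)`, with room
`Q((0,x), r) ⊆ K`: there are a scale `s > 0` and bounds `B, B′` such that for all large `k` and every `x ∈ X`,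
`‖v_k‖ ≤ B` and `‖∇ v_k‖ ≤ B′` POINTWISE on `Q((0, x), s/2)` (`eventually_bounds_near_lid`).  (Finite subcover of `X`
by the half-balls of backward regularity ⇒ a uniform radius and level; S5a ⇒ one scale `s` with `C + D` small at every
`(s, (0,x))`; S5b ⇒ smooth representatives; S5c ⇒ pointwise bounds.)

Seat ns-atd-p1 (LEAD g2).  WHAT THIS IS NOT: not a statement about Navier–Stokes regularity; a compactness tool
serving a STAGED door route.  Lands `--supports` the crux item as a helper.
-/

noncomputable section

set_option linter.dupNamespace false

namespace Summit.NavierStokesRegularity.NavierStokesRegularity.Theorems.AveragedConeLiouville.LidBounds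

open scoped ENNReal NNReal Topology
open Set Function MeasureTheory Metric Filter TopologicalSpace
open Literature.Analysis.FluidPDE
open Summit.NavierStokesRegularity.NavierStokesRegularity.Theorems.AveragedConeLiouville.SmallScales
open Summit.NavierStokesRegularity.NavierStokesRegularity.Theorems.AveragedConeLiouville.SmoothRep
open Summit.NavierStokesRegularity.NavierStokesRegularity.Theorems.AveragedConeLiouville.Unzoom

/-- A backward cylinder about a nearby lid point lies in a bigger one: `Q((0,x), r₁) ⊆ Q((0,x₀), ρ)` when
`dist x x₀ < ρ/2` and `r₁ ≤ ρ/2`. -/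
theorem parabolicCylinder_lid_mono {x x₀ : EuclideanSpace ℝ (Fin 3)} {r₁ ρ : ℝ} (hr₁ : 0 < r₁) (hd : dist x x₀ < ρ / 2)
    (hle : r₁ ≤ ρ / 2) :
    parabolicCylinder r₁ (((0 : ℝ), x) : ℝ × EuclideanSpace ℝ (Fin 3)) ⊆ parabolicCylinder ρ ((0 : ℝ), x₀) := by
  rintro ⟨t, y⟩ h
  rw [mem_parabolicCylinder] at h ⊢
  obtain ⟨⟨h1, h2⟩, h3⟩ := h
  simp only at h1 h2 h3 ⊢
  refine ⟨⟨by nlinarith, h2⟩, ?_⟩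
  calc dist y x₀ ≤ dist y x + dist x x₀ := dist_triangle _ _ _
    _ < r₁ + ρ / 2 := add_lt_add h3 hd
    _ ≤ ρ := by linarith

/-- **Eventual pointwise bounds below a compact set of backward-regular lid points.** -/
theorem eventually_bounds_near_lid
    {v : ℕ → ℝ → EuclideanSpace ℝ (Fin 3) → EuclideanSpace ℝ (Fin 3)}
    {q : ℕ → ℝ → EuclideanSpace ℝ (Fin 3) → ℝ}
    {u : ℝ → EuclideanSpace ℝ (Fin 3) → EuclideanSpace ℝ (Fin 3)}
    (hball : ∀ k, IsSuitableWeakSolutionInBall 1 0 (v k) (q k))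
    (hcont : ∀ k, ContinuousOn (uncurry (v k)) (parabolicCylinder 1 (0 : ℝ × EuclideanSpace ℝ (Fin 3))))
    (hsup : (⨆ k, (eLpNorm (uncurry (v k)) 3
        (volume.restrict (parabolicCylinder 1 (0 : ℝ × EuclideanSpace ℝ (Fin 3)))) +
      eLpNorm (uncurry (q k)) (3 / 2)
        (volume.restrict (parabolicCylinder 1 (0 : ℝ × EuclideanSpace ℝ (Fin 3)))))) < ∞)
    {K : Set (ℝ × EuclideanSpace ℝ (Fin 3))} (hKO : K ⊆ parabolicCylinder 1 (0 : ℝ × EuclideanSpace ℝ (Fin 3)))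
    (hlim : Tendsto (fun k => eLpNorm (uncurry (v k) - uncurry u) 3 (volume.restrict K)) atTop (𝓝 0))
    {X : Set (EuclideanSpace ℝ (Fin 3))} (hX : IsCompact X) {r : ℝ} (hr : 0 < r)
    (hroom : ∀ x ∈ X, parabolicCylinder r (((0 : ℝ), x) : ℝ × EuclideanSpace ℝ (Fin 3)) ⊆ K)
    (hreg : ∀ x ∈ X, ¬ IsBackwardSingularPoint u ((0 : ℝ), x)) :
    ∃ s B B' : ℝ, 0 < s ∧ s ≤ r ∧ ∀ᶠ k in atTop, ∀ x ∈ X,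
      ∀ w ∈ parabolicCylinder (s / 2) (((0 : ℝ), x) : ℝ × EuclideanSpace ℝ (Fin 3)),
        ‖v k w.1 w.2‖ ≤ B ∧ ‖fderiv ℝ (v k w.1) w.2‖ ≤ B' := by
  -- radii and levels of backward regularity
  have hrad : ∀ x ∈ X, ∃ ρ : ℝ, 0 < ρ ∧ eLpNorm (uncurry u) ∞
      (volume.restrict (parabolicCylinder ρ (((0 : ℝ), x) : ℝ × EuclideanSpace ℝ (Fin 3)))) ≠ ∞ := by
    intro x hx
    have h := hreg x hx
    simp only [IsBackwardSingularPoint, not_forall] at h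
    obtain ⟨ρ, hρ, hne⟩ := h
    exact ⟨ρ, hρ, hne⟩
  choose! ρ hρ hfin using hrad
  -- finite subcover of `X` by the balls `B(x, ρ_x/2)`
  obtain ⟨J, hJsub, hJfin, hJcov⟩ := hX.elim_finite_subcover_image (b := X) (c := fun x => ball x (ρ x / 2))
    (fun x _ => isOpen_ball) (fun x hx => mem_iUnion₂.2 ⟨x, hx, mem_ball_self (by linarith [hρ x hx])⟩)
  rcases X.eq_empty_or_nonempty with hXe | hXne
  · refine ⟨r, 0, 0, hr, le_rfl, Eventually.of_forall fun k x hx => ?_⟩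
    rw [hXe] at hx; exact absurd hx (notMem_empty x)
  have hJne : J.Nonempty := by
    obtain ⟨x, hx⟩ := hXne
    obtain ⟨i, hi, -⟩ := mem_iUnion₂.1 (hJcov hx)
    exact ⟨i, hi⟩
  obtain ⟨Jf, hJf⟩ := hJfin.exists_finset_coe
  have hJfne : Jf.Nonempty := by
    obtain ⟨i, hi⟩ := hJne
    exact ⟨i, by rw [← Finset.mem_coe, hJf]; exact hi⟩
  have hJfX : ∀ i ∈ Jf, i ∈ X := fun i hi => hJsub (by rw [← hJf]; exact Finset.mem_coe.2 hi)
  -- uniform radius and level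
  set r₁ : ℝ := min r (Jf.inf' hJfne fun i => ρ i / 2) with hr₁
  have hr₁pos : 0 < r₁ := by
    refine lt_min hr ?_
    obtain ⟨i, hi, heq⟩ := Finset.exists_mem_eq_inf' hJfne fun i => ρ i / 2
    rw [heq]; linarith [hρ i (hJfX i hi)]
  have hr₁r : r₁ ≤ r := min_le_left _ _
  have hr₁ρ : ∀ i ∈ Jf, r₁ ≤ ρ i / 2 := fun i hi => (min_le_right _ _).trans (Finset.inf'_le _ hi)
  set M : ℝ≥0∞ := Jf.sup fun i => eLpNorm (uncurry u) ∞
    (volume.restrict (parabolicCylinder (ρ i) (((0 : ℝ), i) : ℝ × EuclideanSpace ℝ (Fin 3)))) with hM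
  have hMtop : M ≠ ∞ := by
    rw [hM, ne_eq, Finset.sup_eq_top_iff]
    push Not
    intro i hi
    exact hfin i (hJfX i hi)
  -- the a.e. bound `|u| ≤ M` on `Q((0,x), r₁)` for every `x ∈ X`
  have hMbound : ∀ x ∈ X, ∀ᵐ w ∂(volume.restrict (parabolicCylinder r₁ (((0 : ℝ), x) : ℝ × EuclideanSpace ℝ (Fin 3)))),
      ‖u w.1 w.2‖ₑ ≤ M := by
    intro x hx
    obtain ⟨i, hi, hxi⟩ := mem_iUnion₂.1 (hJcov hx)
    have hiJf : i ∈ Jf := by rw [← Finset.mem_coe, hJf]; exact hi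
    have hsub : parabolicCylinder r₁ (((0 : ℝ), x) : ℝ × EuclideanSpace ℝ (Fin 3)) ⊆ parabolicCylinder (ρ i) ((0 : ℝ), i) :=
      parabolicCylinder_lid_mono hr₁pos (mem_ball.1 hxi) (hr₁ρ i hiJf)
    have h1 := ae_restrict_of_ae_restrict_of_subset hsub (ae_enorm_le_eLpNorm_top u (parabolicCylinder (ρ i) ((0 : ℝ), i)))
    filter_upwards [h1] with w hw
    exact hw.trans (Finset.le_sup (f := fun i => eLpNorm (uncurry u) ∞
      (volume.restrict (parabolicCylinder (ρ i) (((0 : ℝ), i) : ℝ × EuclideanSpace ℝ (Fin 3))))) hiJf)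
  -- the universal constants of the smooth representative, and one small scale
  obtain ⟨εS, hεS, c₀, hrep⟩ := exists_smooth_rep_of_small
  obtain ⟨s, hs, hsr₁, hev⟩ := eventually_small_cknC_add_cknD hball hsup hKO hlim hr₁pos hMtop hεS
  refine ⟨s, c₀ 0 / s, c₀ 1 / s ^ 2, hs, hsr₁.trans hr₁r, ?_⟩
  filter_upwards [hev] with k hk x hx w hw
  have hKx : parabolicCylinder r₁ (((0 : ℝ), x) : ℝ × EuclideanSpace ℝ (Fin 3)) ⊆ K :=
    (parabolicCylinder_mono hr₁pos.le hr₁r _).trans (hroom x hx)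
  have hsmall := hk ((0 : ℝ), x) hKx (hMbound x hx)
  have hsubs : parabolicCylinder s (((0 : ℝ), x) : ℝ × EuclideanSpace ℝ (Fin 3)) ⊆
      parabolicCylinder 1 (0 : ℝ × EuclideanSpace ℝ (Fin 3)) :=
    ((parabolicCylinder_mono hs.le hsr₁ _).trans hKx).trans hKO
  obtain ⟨W, hae, hWd, hWk⟩ := hrep (v k) (q k) ((0 : ℝ), x) s hs (hball k) hsubs hsmall
  -- continuity and bounds of the representative
  obtain ⟨⟨C0, α0, hα0, hH0⟩, hb0⟩ := hWk 0
  obtain ⟨-, hb1⟩ := hWk 1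
  have hWc : ContinuousOn (uncurry W) (parabolicCylinder (1 / 2) (0 : ℝ × EuclideanSpace ℝ (Fin 3))) := by
    have h1 := hH0.continuousOn hα0
    have h2 : uncurry W = (continuousMultilinearCurryFin0 ℝ (EuclideanSpace ℝ (Fin 3)) (EuclideanSpace ℝ (Fin 3))) ∘
        (fun w : ℝ × EuclideanSpace ℝ (Fin 3) => iteratedFDeriv ℝ 0 (W w.1) w.2) := by
      funext w
      simp [iteratedFDeriv_zero_eq_comp, uncurry]
    rw [h2]
    exact (continuousMultilinearCurryFin0 ℝ (EuclideanSpace ℝ (Fin 3)) (EuclideanSpace ℝ (Fin 3))).continuous.comp_continuousOn h1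
  have hWdiff : ∀ w' ∈ parabolicCylinder (1 / 2) (0 : ℝ × EuclideanSpace ℝ (Fin 3)), DifferentiableAt ℝ (W w'.1) w'.2 :=
    fun w' hw' => (hWd w' hw').differentiableAt (by simp)
  have h0 : ∀ w' ∈ parabolicCylinder (1 / 2) (0 : ℝ × EuclideanSpace ℝ (Fin 3)), ‖W w'.1 w'.2‖ ≤ c₀ 0 := by
    intro w' hw'
    have := hb0 w' hw'
    rwa [norm_iteratedFDeriv_zero] at this
  have hvc : ContinuousOn (uncurry (v k)) (parabolicCylinder s (((0 : ℝ), x) : ℝ × EuclideanSpace ℝ (Fin 3))) :=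
    (hcont k).mono hsubs
  exact pointwise_bounds_of_smooth_rep hs hvc hae hWc hWdiff h0 hb1 w hw

end Summit.NavierStokesRegularity.NavierStokesRegularity.Theorems.AveragedConeLiouville.LidBounds

end
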